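import Summits.BirchSwinnertonDyer.BirchSwinnertonDyer.Theorems.UniversalToricDescentLocalH1Divisible
import Summits.BirchSwinnertonDyer.BirchSwinnertonDyer.Theorems.UniversalToricDescentLocalTermGreenbergVatsal
import Literature.NumberTheory.EllipticCurves.TateModuleReductionKernelProofs
import HarnessLib

/-!
# Route UniversalToricDescent — Greenberg–Vatsal Prop. (2.4) for `E[p^∞]` in full:
# `H¹(K_{∞,w}, E[p^∞])` is `p`-divisible with `#[p^k] = p^{k·s_v}`, i.e. `≅ (ℚ_p/ℤ_p)^{s_v}`, `s_v = d_v`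

Lead prover bsd-wall-utd-p1 g11 (`--supports stmt-BirchSwinnertonDyer-20399`; sequel of
`UniversalToricDescentLocalH1Divisible`, whose `exists_nsmul_eq_subgroupH1_localSubgroup` gives the
`p`-divisibility of `H¹(K_{∞,w}, A)` for an abstract `A`). Here `A = E[p^∞]` for an elliptic curve `E/K`
(ANY reduction type at `v`), `κ` any `ℤ_p`-extension of the number field `K`, `v ∤ p` finitely decomposed
in `K_∞` (`D_v ⊄ ker κ`), in the three currencies of the tree:

* `exists_nsmul_eq_subgroupH1_localSubgroup_primaryTorsion` — `H¹(localSubgroup (ker κ) K_v, E[p^∞])`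
  (`Γ_{K_v}` acting through `absGaloisRestrict`, the `PrimaryTorsion` model) is `p`-divisible;
* `exists_nsmul_eq_subgroupH1_inf_decomp` — `H¹(ker κ ⊓ D_v, E[p^∞])` is `p`-divisible (the currency of
  `GreenbergVatsal2000.NonPrimitiveSelmerGroup`, the cyclotomic / fine-Selmer files and X2);
* **`exists_nsmul_eq_subgroupH1_kerD`** — `H¹(kerD κ v, E[p^∞])` is `p`-divisible (the currency of the
  route's Σ-local files `UniversalToricDescentSigmaLocal*` and of the closed-form count
  `natCard_pTorsion_subgroupH1_kerD_eq_pow_ite`);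
* **`natCard_pow_torsion_subgroupH1_kerD_eq_pow_mul`** — hence ALL layer counts:
  `#H¹(kerD κ v, E[p^∞])[p^k] = p^{s_v k}` whenever `#H¹(kerD κ v, E[p^∞])[p] = p^{s_v}` — with the closed
  form of `s_v` (`…LocalTermClosedForm`) this is `H¹(K_{∞,w}, E[p^∞]) ≅ (ℚ_p/ℤ_p)^{s_v}` numerically at
  every layer, Greenberg–Vatsal's Prop. (2.4) as printed; over `ℚ`:
  `natCard_pow_torsion_subgroupH1_kerD_eq_pow_dMultiplicity_mul`, `#[p^k] = p^{d_ℓ k}` with the X2 cell's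
  `GreenbergVatsal2000.dMultiplicity`.

Transports: `Hi ⇄ ker κ ⊓ D_v` (`absGaloisRangeEquivCompletion`, as in
`UniversalToricDescentMultiplicativeLocalTerm`) and `kerD κ v ⇄ ker κ ⊓ D_v` are pairs of mutually
inverse continuous isomorphisms, so one of the two inflations is ONTO (`resH1Hom_comp`, `resH1Hom_id`), and
the image of a `p`-divisible group is `p`-divisible. Layer counts: `TateModule.card_torsionBy_pow_of_divisible`.

THEOREMS ONLY; no definition, no named fact, no `sorry`. BSD is not advanced by this file.
References: [GreenbergVatsal2000] §2 Prop. (2.4) and proof (arXiv p. 22); [GreenbergLNM1716] §3 Lemma 3.3.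
-/

set_option autoImplicit false
-- `…BirchSwinnertonDyer.BirchSwinnertonDyer.Theorems…` is the problem's mandated namespace (D-0017).
set_option linter.dupNamespace false

noncomputable section

open scoped Classical

namespace Summit.BirchSwinnertonDyer.BirchSwinnertonDyer.Theorems.UniversalToricDescentLocalH1Divisible

open Function NumberField IsDedekindDomain Field WeierstrassCurve ValuativeRel
open Literature.NumberTheory.EllipticCurves Literature.NumberTheory.EllipticCurves.GreenbergSelmer
  Literature.NumberTheory.GaloisRepresentations IsDedekindDomain.HeightOneSpectrum
  Literature.NumberTheory.EllipticCurves.BigGaloisRep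
  Literature.NumberTheory.GaloisRepresentations.IsNonarchimedeanLocalField
  Summit.BirchSwinnertonDyer.Rank1Residual.X11b Summit.BirchSwinnertonDyer.Rank1Residual.X11b.Coinv
  Summit.BirchSwinnertonDyer.Rank1Residual.Iwasawa
  Summit.BirchSwinnertonDyer.BirchSwinnertonDyer.Theorems.SigmaLocal

/-! ### §1 Layer counts of a `p`-divisible group -/

section Layers

variable {A : Type} [AddCommGroup A] {p : ℕ}

/-- **Layer counts of a `p`-divisible group**: if `A` is `p`-divisible and `#{a : p•a = 0} = p^s` then
`#{a : p^k • a = 0} = p^{s k}` (subtype currency of the tree's `TateModule.card_torsionBy_pow_of_divisible`).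
[folklore] -/
theorem natCard_pow_torsion_eq_pow_mul_of_divisible (hdiv : ∀ a : A, ∃ b : A, p • b = a) {s : ℕ}
    (hs : Nat.card {a : A // p • a = 0} = p ^ s) (k : ℕ) :
    Nat.card {a : A // p ^ k • a = 0} = p ^ (s * k) := by
  have e : ∀ n : ℕ, Nat.card {a : A // n • a = 0} = Nat.card (AddSubgroup.torsionBy A n) := fun n ↦
    Nat.card_congr (Equiv.subtypeEquivRight fun a ↦ (AddSubgroup.torsionBy.nsmul_iff).symm)
  rw [e]
  rw [e] at hs
  exact TateModule.card_torsionBy_pow_of_divisible hdiv hs k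

end Layers

/-! ### §2 `E[p^∞]` over `K_{∞,w}`: three currencies -/

section Curve

variable {K : Type} [Field K] [NumberField K] (W : WeierstrassCurve K) [W.IsElliptic] {p : ℕ}
  [Fact p.Prime] (κ : ZpExtension K p) {v : HeightOneSpectrum (𝓞 K)}

/-- **`H¹(K_{∞,w}, E[p^∞])` is `p`-divisible** (local currency): for `E/K` elliptic (any reduction type at
`v`), any `ℤ_p`-extension `κ`, `v ∤ p` with `D_v ⊄ ker κ`, and `Γ_{K_v}` acting on `E[p^∞] = PrimaryTorsion`
through `absGaloisRestrict K K_v`: every class of `H¹(localSubgroup (ker κ) K_v, E[p^∞])` is `p` times a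
class (`exists_nsmul_eq_subgroupH1_localSubgroup` with `E[p^∞]` `p`-primary, divisible, of finite layers).
[cite: GreenbergVatsal2000, §2 Prop. (2.4) and proof (arXiv p. 22)] -/
theorem exists_nsmul_eq_subgroupH1_localSubgroup_primaryTorsion (hpv : (p : 𝓞 K) ∉ v.asIdeal)
    (hD : ¬ (decomp v ≤ κ.kerSubgroup)) :
    letI : DistribMulAction (absoluteGaloisGroup (v.adicCompletion K)) (geomPoints W) :=
      DistribMulAction.compHom _ (absGaloisRestrict K (v.adicCompletion K)).toMonoidHom
    ∀ x : Literature.NumberTheory.EllipticCurves.subgroupH1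
        (localSubgroup κ.kerSubgroup (v.adicCompletion K)) (PrimaryTorsion (geomPoints W) p),
      ∃ x' : Literature.NumberTheory.EllipticCurves.subgroupH1
        (localSubgroup κ.kerSubgroup (v.adicCompletion K)) (PrimaryTorsion (geomPoints W) p),
        p • x' = x := by
  letI inst : DistribMulAction (absoluteGaloisGroup (v.adicCompletion K)) (geomPoints W) :=
    DistribMulAction.compHom _ (absGaloisRestrict K (v.adicCompletion K)).toMonoidHom
  -- notation
  let Fv := v.adicCompletion K
  let G : Type := absoluteGaloisGroup Fv
  let Hi : Subgroup G := localSubgroup κ.kerSubgroup Fv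
  let A' : Type := PrimaryTorsion (geomPoints W) p
  -- `v` not split completely: some `σ ∈ Γ_{K_v}` restricts outside `ker κ`
  have hns : ∃ σ : G, σ ∉ Hi := by
    by_contra hall
    refine hD fun g hg ↦ ?_
    obtain ⟨σ, rfl⟩ := (mem_decomp_iff v g).mp hg
    have hσ : σ ∈ Hi := not_not.mp fun h ↦ hall ⟨σ, h⟩
    have h := (mem_localSubgroup_iff κ.kerSubgroup Fv σ).mp hσ
    rwa [resGal_eq_absGaloisRestrict] at h
  -- the hypotheses on `E[p^∞]`
  let ρ' : ContinuousRep G ℤ_[p] A' := (W.primaryTorsionGaloisRep p).restrict (localMap K (Sum.inl v))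
  have hcont : ∀ a : A', Continuous fun g : G ↦ g • a := fun a ↦ ρ'.continuous_apply_left a
  have hA : ∀ a : A', ∃ k : ℕ, p ^ k • a = 0 := primaryTorsion_exists_pow_nsmul_eq_zero W p
  have hfin : ∀ k : ℕ, Set.Finite {a : A' | p ^ k • a = 0} :=
    primaryTorsion_setOf_pow_nsmul_eq_zero_finite W p
  have hdiv : ∀ a : A', ∃ b : A', p • b = a := W.smul_surjective_primaryTorsion p
  intro x
  exact exists_nsmul_eq_subgroupH1_localSubgroup κ hpv hns hA hdiv hfin hcont x

/-- **`H¹(ker κ ⊓ D_v, E[p^∞])` is `p`-divisible** at a place `v ∤ p` finitely decomposed in the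
`ℤ_p`-extension `κ` (global currency `ker κ ⊓ D_v ≤ Γ_K`): the inflation along the continuous isomorphism
`ker κ ⊓ D_v ⥲ Gal(K̄_v/K_{∞,w})` (inverse of `absGaloisRestrict`, `absGaloisRangeEquivCompletion`) is onto
on `H¹`, and the source is `p`-divisible. [cite: GreenbergVatsal2000, §2 Prop. (2.4) and proof (arXiv p. 22)]
[cite: GreenbergLNM1716, §3 Lemma 3.3] -/
theorem exists_nsmul_eq_subgroupH1_inf_decomp (hpv : (p : 𝓞 K) ∉ v.asIdeal)
    (hD : ¬ (decomp v ≤ κ.kerSubgroup))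
    (x : Literature.NumberTheory.EllipticCurves.subgroupH1 (κ.kerSubgroup ⊓ decomp v)
      (W.geomPrimaryTorsion p)) :
    ∃ x' : Literature.NumberTheory.EllipticCurves.subgroupH1 (κ.kerSubgroup ⊓ decomp v)
      (W.geomPrimaryTorsion p), p • x' = x := by
  letI inst : DistribMulAction (absoluteGaloisGroup (v.adicCompletion K)) (geomPoints W) :=
    DistribMulAction.compHom _ (absGaloisRestrict K (v.adicCompletion K)).toMonoidHom
  -- notation
  let Fv := v.adicCompletion K
  let G : Type := absoluteGaloisGroup Fv
  let Hi : Subgroup G := localSubgroup κ.kerSubgroup Fv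
  let D : Subgroup (absoluteGaloisGroup K) := κ.kerSubgroup ⊓ decomp v
  let A : Type := W.geomPrimaryTorsion p
  let A' : Type := PrimaryTorsion (geomPoints W) p
  haveI : CharZero Fv := charZero_of_injective_algebraMap (algebraMap K Fv).injective
  -- the two mutually inverse isomorphisms `Hi ⇄ D` (as in `UniversalToricDescentMultiplicativeLocalTerm`)
  let θ₁ : Hi →ₜ* D :=
    { toFun := fun x ↦ ⟨absGaloisRestrict K Fv x, Subgroup.mem_inf.mpr ⟨by
          have h := (mem_localSubgroup_iff κ.kerSubgroup Fv x.1).mp x.2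
          rwa [resGal_eq_absGaloisRestrict] at h, (mem_decomp_iff v _).mpr ⟨x, rfl⟩⟩⟩
      map_one' := Subtype.ext (by simp)
      map_mul' := fun x y ↦ Subtype.ext (by simp)
      continuous_toFun :=
        ((absGaloisRestrict K Fv).continuous_toFun.comp continuous_subtype_val).subtype_mk _ }
  let e := absGaloisRangeEquivCompletion K v
  have hDr : ∀ x : D, (x : absoluteGaloisGroup K) ∈ (absGaloisRestrict K Fv).range := fun x ↦
    (Subgroup.mem_inf.mp x.2).2
  have hmemHi : ∀ x : D, e.symm ⟨x.1, hDr x⟩ ∈ Hi := fun x ↦ by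
    show e.symm ⟨x.1, hDr x⟩ ∈ localSubgroup κ.kerSubgroup Fv
    rw [mem_localSubgroup_iff, resGal_eq_absGaloisRestrict,
      absGaloisRestrict_absGaloisRangeEquivCompletion_symm]
    exact (Subgroup.mem_inf.mp x.2).1
  let θ₂ : D →ₜ* Hi :=
    { toFun := fun x ↦ ⟨e.symm ⟨x.1, hDr x⟩, hmemHi x⟩
      map_one' := Subtype.ext (by
        show e.symm ⟨((1 : D) : absoluteGaloisGroup K), hDr 1⟩ = 1
        rw [← map_one e.symm]
        rfl)
      map_mul' := fun x y ↦ Subtype.ext (by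
        show e.symm ⟨((x * y : D) : absoluteGaloisGroup K), hDr (x * y)⟩ =
          e.symm ⟨(x : absoluteGaloisGroup K), hDr x⟩ * e.symm ⟨(y : absoluteGaloisGroup K), hDr y⟩
        rw [← map_mul e.symm]
        rfl)
      continuous_toFun :=
        (e.symm.continuous.comp (continuous_subtype_val.subtype_mk fun x ↦ hDr x)).subtype_mk
          fun x ↦ hmemHi x }
  have hθ₂res : ∀ x : D, absGaloisRestrict K Fv (θ₂ x : G) = (x : absoluteGaloisGroup K) := fun x ↦
    absGaloisRestrict_absGaloisRangeEquivCompletion_symm K v ⟨x.1, hDr x⟩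
  have hθ₁₂ : θ₁.comp θ₂ = ContinuousMonoidHom.id D :=
    ContinuousMonoidHom.ext fun x ↦ Subtype.ext (hθ₂res x)
  -- the identity `A ≃ A'` (the same subgroup of `E(K̄)`, two names)
  let ψ : A →+ A' := { toFun := fun a ↦ ⟨a.1, a.2⟩, map_zero' := rfl, map_add' := fun _ _ ↦ rfl }
  let ψ' : A' →+ A := { toFun := fun a ↦ ⟨a.1, a.2⟩, map_zero' := rfl, map_add' := fun _ _ ↦ rfl }
  have hψ : ψ'.comp ψ = AddMonoidHom.id A := AddMonoidHom.ext fun _ ↦ rfl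
  -- the two restrictions and `r₂ ∘ r₁ = id`
  have h₁ : ∀ (x : Hi) (m : A), ψ (θ₁ x • m) = x • ψ m := fun x m ↦ rfl
  have h₂ : ∀ (x : D) (m : A'), ψ' (θ₂ x • m) = x • ψ' m := fun x m ↦ by
    apply Subtype.ext
    show absGaloisRestrict K Fv (θ₂ x : G) • (m : geomPoints W) = (x : absoluteGaloisGroup K) • (m : geomPoints W)
    rw [hθ₂res]
  let r₁ := resH1Hom θ₁ ψ h₁
  let r₂ := resH1Hom θ₂ ψ' h₂
  have hcomp : r₂.comp r₁ = AddMonoidHom.id _ := by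
    rw [resH1Hom_comp, resH1Hom_congr hθ₁₂ hψ _ (fun _ _ ↦ rfl), resH1Hom_id]
  -- transport of divisibility along the surjection `r₂`
  obtain ⟨t, ht⟩ := exists_nsmul_eq_subgroupH1_localSubgroup_primaryTorsion W κ hpv hD (r₁ x)
  refine ⟨r₂ t, ?_⟩
  rw [← map_nsmul, ht]
  exact DFunLike.congr_fun hcomp x

/-- **`H¹(kerD κ v, E[p^∞])` is `p`-divisible** at a place `v ∤ p` finitely decomposed in the
`ℤ_p`-extension `κ` (the route's `kerD κ v ≤ D_v` currency): inflation along the tautological isomorphism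
`kerD κ v ⥲ ker κ ⊓ D_v` is onto on `H¹`. With `#H¹(kerD κ v, E[p^∞])[p] = p^{s_v}`
(`natCard_pTorsion_subgroupH1_kerD_eq_pow_ite`) this is Greenberg–Vatsal's
`H¹(K_{∞,w}, E[p^∞]) ≅ (ℚ_p/ℤ_p)^{s_v}`. [cite: GreenbergVatsal2000, §2 Prop. (2.4) and proof (arXiv p. 22)] -/
theorem exists_nsmul_eq_subgroupH1_kerD (hpv : (p : 𝓞 K) ∉ v.asIdeal)
    (hD : ¬ (decomp v ≤ κ.kerSubgroup))
    (f : Literature.NumberTheory.EllipticCurves.subgroupH1 (kerD κ v) (W.geomPrimaryTorsion p)) :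
    ∃ f' : Literature.NumberTheory.EllipticCurves.subgroupH1 (kerD κ v) (W.geomPrimaryTorsion p),
      p • f' = f := by
  let A : Type := W.geomPrimaryTorsion p
  let D : Subgroup (absoluteGaloisGroup K) := κ.kerSubgroup ⊓ decomp v
  -- the tautological isomorphisms `kerD κ v ⇄ ker κ ⊓ D_v`
  let θ₃ : kerD κ v →ₜ* D :=
    { toFun := fun x ↦ ⟨((x : decomp (K := K) v) : absoluteGaloisGroup K),
        Subgroup.mem_inf.mpr ⟨(mem_kerD_iff κ v _).1 x.2, (x : decomp (K := K) v).2⟩⟩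
      map_one' := rfl
      map_mul' := fun _ _ ↦ rfl
      continuous_toFun := (continuous_subtype_val.comp continuous_subtype_val).subtype_mk _ }
  let θ₄ : D →ₜ* kerD κ v :=
    { toFun := fun x ↦ ⟨⟨(x : absoluteGaloisGroup K), (Subgroup.mem_inf.mp x.2).2⟩,
        (mem_kerD_iff κ v _).2 (Subgroup.mem_inf.mp x.2).1⟩
      map_one' := rfl
      map_mul' := fun _ _ ↦ rfl
      continuous_toFun := (continuous_subtype_val.subtype_mk _).subtype_mk _ }
  have hθ₄₃ : θ₄.comp θ₃ = ContinuousMonoidHom.id (kerD κ v) := ContinuousMonoidHom.ext fun _ ↦ rfl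
  let r₃ := resH1Hom θ₃ (AddMonoidHom.id A) fun x m ↦ (rfl : θ₃ x • m = x • m)
  let r₄ := resH1Hom θ₄ (AddMonoidHom.id A) fun x m ↦ (rfl : θ₄ x • m = x • m)
  have hcomp : r₃.comp r₄ = AddMonoidHom.id _ := by
    rw [resH1Hom_comp, resH1Hom_congr hθ₄₃ (AddMonoidHom.comp_id _) _ (fun _ _ ↦ rfl), resH1Hom_id]
  obtain ⟨t, ht⟩ := exists_nsmul_eq_subgroupH1_inf_decomp W κ hpv hD (r₄ f)
  refine ⟨r₃ t, ?_⟩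
  rw [← map_nsmul, ht]
  exact DFunLike.congr_fun hcomp f

/-- **All layer counts of the local term**: at `v ∤ p` finitely decomposed in `κ`, if
`#H¹(kerD κ v, E[p^∞])[p] = p^{s}` then `#H¹(kerD κ v, E[p^∞])[p^k] = p^{s k}` for every `k` — the group is
`p`-divisible (`exists_nsmul_eq_subgroupH1_kerD`). [cite: GreenbergVatsal2000, §2 Prop. (2.4) (arXiv p. 22)] -/
theorem natCard_pow_torsion_subgroupH1_kerD_eq_pow_mul (hpv : (p : 𝓞 K) ∉ v.asIdeal)
    (hD : ¬ (decomp v ≤ κ.kerSubgroup)) {s : ℕ}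
    (hs : Nat.card {f : Literature.NumberTheory.EllipticCurves.subgroupH1 (kerD κ v)
        (W.geomPrimaryTorsion p) // p • f = 0} = p ^ s) (k : ℕ) :
    Nat.card {f : Literature.NumberTheory.EllipticCurves.subgroupH1 (kerD κ v)
        (W.geomPrimaryTorsion p) // p ^ k • f = 0} = p ^ (s * k) :=
  natCard_pow_torsion_eq_pow_mul_of_divisible (exists_nsmul_eq_subgroupH1_kerD W κ hpv hD) hs k

end Curve

/-! ### §3 Over `ℚ`: `#H¹(K_{∞,w}, E[p^∞])[p^k] = p^{k d_ℓ}` -/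

section Rat

open Literature.NumberTheory.EllipticCurves.GreenbergVatsal2000
  Summit.BirchSwinnertonDyer.BirchSwinnertonDyer.Theorems.UniversalToricDescentLocalTermClosedForm

variable (W : WeierstrassCurve ℚ) [W.IsElliptic] {p : ℕ} [hp : Fact p.Prime] (κ : ZpExtension ℚ p)
  {v : HeightOneSpectrum (𝓞 ℚ)}

/-- **Greenberg–Vatsal Prop. (2.4) over `ℚ`, all layers**: for `E/ℚ`, any `ℤ_p`-extension `κ` of `ℚ`, a
place `v = (ℓ)`, `ℓ ≠ p`, finitely decomposed in `κ`, and every `k`: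
`#{f ∈ H¹(kerD κ v, E[p^∞]) : p^k • f = 0} = p^{d_ℓ k}` with `d_ℓ = GreenbergVatsal2000.dMultiplicity E p v`
(the multiplicity of `ℓ̃⁻¹` as a root of `P̃_ℓ mod p`); i.e. `H¹(ℚ_{∞,η}, E[p^∞]) ≅ (ℚ_p/ℤ_p)^{d_ℓ}`.
[cite: GreenbergVatsal2000, §2 Prop. (2.4) (arXiv p. 22) and p. 27] -/
theorem natCard_pow_torsion_subgroupH1_kerD_eq_pow_dMultiplicity_mul (hpv : (p : 𝓞 ℚ) ∉ v.asIdeal)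
    (hD : ¬ (decomp v ≤ κ.kerSubgroup)) (k : ℕ) :
    Nat.card {f : Literature.NumberTheory.EllipticCurves.subgroupH1 (kerD κ v)
        (W.geomPrimaryTorsion p) // p ^ k • f = 0} = p ^ (dMultiplicity W p v * k) :=
  natCard_pow_torsion_subgroupH1_kerD_eq_pow_mul W κ hpv hD
    (natCard_pTorsion_subgroupH1_kerD_eq_pow_dMultiplicity W κ hpv hD) k

end Rat

end Summit.BirchSwinnertonDyer.BirchSwinnertonDyer.Theorems.UniversalToricDescentLocalH1Divisible

end
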